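import Literature.NumberTheory.EllipticCurves.ShaCorestrictionIndexTwo
import HarnessLib

/-!
# Route `GenusKolyvaginAtTwo`, crux U_T `ShaCardDvdPowAtTwoRT` (stmt-BirchSwinnertonDyer-23658), LINE 19 `rational_pair_descent`,
# stub SANDWICH′: THE GENERIC INDEX-`2` INFLATION–RESTRICTION SURJECTIVITY — a `c_*`-invariant class of `H¹(N, M)` is a
# restriction from `G` as soon as `Ĥ⁰(⟨c⟩, M^N) = 0`; for `E/ℚ` and a quadratic `K`: every `τ_*`-invariant class of
# `H¹(K, E_K)` is a restriction from `H¹(ℚ, E)` when every point of `E(ℚ)` is twice a point of `E(ℚ)` (e.g. `E(ℚ)` odd torsion)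

Seat `bsd-line-gk2-p1` g19 (LEAD, cell `bsd-f1-sign2`), `--supports stmt-BirchSwinnertonDyer-23658` (helper; closes nothing).
THEOREMS ONLY (no definition, no named fact, no instance, no `sorry`).  BSD is NOT proved by any of this; U_T is not proved.

WHY (LEAD memo `Cruxes/ShaCardDvdPowAtTwoRT/Lines/rational-pair-descent-lead-g19.md` §1c/§6c).  On U_T's live configuration the count
`#Ш(E/K)[2^∞] ∣ 2 · #Ш(E/ℚ)[2^∞]` (stub `stub_sandwichOfMinimalTwin`) loses one bit too many at finite level unless every τ-fixed class of
`Ш(E/K)[2^∞]` is known to be a RESTRICTION of a class of `H¹(ℚ, E)` (then it has a τ-invariant Selmer lift).  The tree's index-`2`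
machinery (`H1CorestrictionIndexTwo`: `res ∘ cor = 1 + c_*`, `cor ∘ res = 2`) gives only `2ξ ∈ im res`; the CM files
(`ShaRestrictionJZeroCorestriction`, `PrintCf2SplitBadTwoCMShaDescentSurjective`) dodge the obstruction with a special endomorphism.  This file
proves the general statement by the explicit extension of an invariant crossed homomorphism across `G = N ⊔ N c` (Serre, *Galois Cohomology*
I §2.6 (b); Lang, *Topics in Cohomology of Groups* VI §2: the transgression obstruction lives in `H²(G/N, M^N) = Ĥ⁰(⟨c⟩, M^N)`):

* §1 **`exists_resSubgroupH1_eq_of_conjH1_eq_of_tateH0`**: if `Ĥ⁰(⟨c⟩, M^N) = 0` in element form (every `N`-fixed, `c`-fixed `d` is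
  `e + c • e` with `e` `N`-fixed), then every `ξ ∈ H¹(N, M)` with `c_* ξ = ξ` is `res η`.  Proof: `c_* ξ = ξ` gives `m₀` with
  `c • f(c⁻¹ n c) − f(n) = n • m₀ − m₀`; hence (K1) `f(c n c⁻¹) = c • f(n) + x − (c n c⁻¹) • x` holds for `x = m₀`, the defect
  `d := f(c²) − m₀ − c • m₀` is `N`-fixed and `c`-fixed, so `d = e + c • e`, and with `x = m₀ + e` also (K2) `f(c²) = x + c • x`;
  then `F(n) = f(n)`, `F(n c) = f(n) + n • x` is a continuous crossed homomorphism on `G` restricting to `f` (the SAME four-coset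
  computation as the tree's transfer `corFun`, with the symmetrised cocycle replaced by `f` and `f(c²)` by `x`).  Corollary
  `…_of_twoDivisible` (the case `M^G ⊆ 2 · M^G`: `d = 2e = e + c • e`).
* §2 **`exists_resBaseChange_eq_of_conjH1Points_eq_of_twoDivisible`**: for `E = W/ℚ`, `K` quadratic (`[K:ℚ] = 2`, `σ ≠ 1`,
  `τ = liftAut σ`), if every `Γ_ℚ`-fixed point of `E(ℚ̄)` is twice a `Γ_ℚ`-fixed point, then every `s ∈ H¹(K, E_K)` with `τ_* s = s`
  is `resBaseChange W K c` for some `c ∈ H¹(ℚ, E)` (transport through the tree's model map `galH1Model`, `galH1Model_resBaseChange`,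
  `galH1Model_conjH1Points`, `galH1ModelInv_galH1Model`).

References: [SerreGaloisCohomology1997] I §2.6 (b), I §5.8; [NeukirchSchmidtWingberg2008] I §6 Prop. 1.6.7; [Lang1996TopicsCohomology]
VI §2 Thm. 2.3; [GrossLMS1991] §5 (5.1)–(5.2).
-/

set_option autoImplicit false
set_option linter.dupNamespace false

noncomputable section

open scoped Classical

namespace Summit.BirchSwinnertonDyer.BirchSwinnertonDyer.Theorems.GenusExact.PlusDescent

open Literature.NumberTheory.EllipticCurves Literature.NumberTheory.GaloisRepresentations WeierstrassCurve

universe u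

/-! ## §1 Invariant classes are restrictions when `Ĥ⁰(⟨c⟩, M^N) = 0` (explicit extension across `G = N ⊔ N c`) -/

section InfRes

variable {G : Type u} [Group G] [TopologicalSpace G] [IsTopologicalGroup G]
variable {N : Subgroup G} [N.Normal] {c : G}
variable {M : Type u} [AddCommGroup M] [DistribMulAction G M] [TopologicalSpace M] [DiscreteTopology M]

/-- **INFLATION–RESTRICTION SURJECTIVITY IN INDEX `2`.**  Let `N ≤ G` be an open normal subgroup with `G = N ⊔ N c`, `M` a discrete
`G`-module with continuous orbit maps, and suppose `Ĥ⁰(⟨c⟩, M^N) = 0` in element form: every `d ∈ M` fixed by `N` and by `c` is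
`e + c • e` for some `N`-fixed `e`.  Then every class `ξ ∈ H¹(N, M)` with `c_* ξ = ξ` is the restriction of a class of `H¹(G, M)`.
(The transgression obstruction `tg ξ ∈ H²(G/N, M^N) = Ĥ⁰(⟨c⟩, M^N)` vanishes.)  Proof by explicit extension of an invariant crossed
homomorphism (§1). [cite: SerreGaloisCohomology1997, I §2.6 (b)] [cite: NeukirchSchmidtWingberg2008, I §6 Prop. 1.6.7] -/
theorem exists_resSubgroupH1_eq_of_conjH1_eq_of_tateH0 (hN : IsOpen (N : Set G)) (hM : ∀ m : M, Continuous fun g : G ↦ g • m)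
    (hc : ∀ b : G, Xor (b * c⁻¹ ∈ N) (b ∈ N))
    (h0 : ∀ d : M, (∀ n : N, (n : G) • d = d) → c • d = d → ∃ e : M, (∀ n : N, (n : G) • e = e) ∧ d = e + c • e)
    {ξ : subgroupH1 N M} (hξ : conjH1 N M c ξ = ξ) :
    ∃ η : discreteH1 G M, resSubgroupH1 N M η = ξ := by
  obtain ⟨f, rfl⟩ := oneCocycleClass_surjective _ ξ
  -- `c_* [f] = [f]`: `c • f(c⁻¹ n c) − f(n) = n • m₀ − m₀`
  rw [conjH1_oneCocycleClass, ← sub_eq_zero, ← oneCocycleClass_sub] at hξ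
  obtain ⟨m₀, hm₀⟩ := (oneCocycleClass_eq_zero_iff _ _).mp hξ
  have hI : ∀ n : N, c • f.1 (subgroupConj N c n) - f.1 n = (n : G) • m₀ - m₀ := fun n ↦ by
    have h := hm₀ n
    rw [sub_apply_val, conjCocycle_apply, discreteTopRep_ρ_apply, Subgroup.smul_def] at h
    exact h
  -- (K1) for `(f, m₀)`: substitute `n ↦ c n c⁻¹`
  have hK1₀ : ∀ n : N, f.1 (cConj c n) = c • f.1 n + m₀ - (c * n * c⁻¹) • m₀ := fun n ↦ by
    have h := hI (cConj c n)
    rw [subgroupConj_cConj, cConj_coe] at h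
    -- `c • f n - f (c n c⁻¹) = (c n c⁻¹) • m₀ - m₀`
    have h' : f.1 (cConj c n) = c • f.1 n - ((c * n * c⁻¹) • m₀ - m₀) := by rw [← h]; abel
    rw [h']
    abel
  -- the defect `d = f(c²) − m₀ − c • m₀` is fixed by `c` …
  set d : M := f.1 (cSq hc) - m₀ - c • m₀ with hd
  have hcSq : subgroupConj N c (cSq hc) = cSq hc := Subtype.ext (by simp)
  have hdc : c • d = d := by
    have h := hI (cSq hc)
    rw [hcSq, cSq_coe, mul_smul] at h
    -- `c • f(c²) = (c • c • m₀ - m₀) + f(c²)`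
    have h' := eq_add_of_sub_eq h
    rw [hd, smul_sub, smul_sub, h']
    abel
  -- … and by `N`
  have hdN : ∀ n : N, (n : G) • d = d := by
    intro n
    -- `n • f(c²) = f(n c²) - f(n)` and `n c² = c² · (c⁻² n c²)`
    set n' : N := subgroupConj N c (subgroupConj N c n) with hn'
    have e : n * cSq hc = cSq hc * n' := by
      apply Subtype.ext
      simp only [Subgroup.coe_mul, cSq_coe, hn', subgroupConj_apply_coe]
      simp only [mul_assoc, mul_inv_cancel_left]
    have h1 : f.1 (n * cSq hc) = f.1 n + (n : G) • f.1 (cSq hc) := cocycle_mul N f n (cSq hc)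
    have h2 : f.1 (cSq hc * n') = f.1 (cSq hc) + (c * c) • f.1 n' := by
      rw [cocycle_mul N f (cSq hc) n', cSq_coe]
    -- `c • f(n') = ((c⁻¹ n c) • m₀ - m₀) + f(c⁻¹ n c)` and `c • f(c⁻¹ n c) = (n • m₀ - m₀) + f(n)`
    have h3 : c • f.1 n' = ((c⁻¹ * n * c) • m₀ - m₀) + f.1 (subgroupConj N c n) := by
      have h := hI (subgroupConj N c n)
      rw [← hn', subgroupConj_apply_coe] at h
      exact eq_add_of_sub_eq h
    have h4 : c • f.1 (subgroupConj N c n) = ((n : G) • m₀ - m₀) + f.1 n := eq_add_of_sub_eq (hI n)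
    have h5 : (c * c) • f.1 n' = f.1 n + (n : G) • m₀ - m₀ + ((n : G) * c) • m₀ - c • m₀ := by
      rw [mul_smul, h3, smul_add, smul_sub, h4, smul_smul,
        show c * (c⁻¹ * (n : G) * c) = (n : G) * c by group]
      abel
    have key : (n : G) • f.1 (cSq hc) = f.1 (cSq hc) + (n : G) • m₀ - m₀ + ((n : G) * c) • m₀ - c • m₀ := by
      have h := h1
      rw [e, h2, h5] at h
      -- `h : f(c²) + (f n + n•m₀ - m₀ + (n c)•m₀ - c•m₀) = f n + n • f(c²)`
      calc (n : G) • f.1 (cSq hc) = (f.1 n + (n : G) • f.1 (cSq hc)) - f.1 n := by abel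
        _ = (f.1 (cSq hc) + (f.1 n + (n : G) • m₀ - m₀ + ((n : G) * c) • m₀ - c • m₀)) - f.1 n := by rw [h]
        _ = _ := by abel
    rw [hd, smul_sub, smul_sub, key, smul_smul]
    abel
  -- `Ĥ⁰ = 0`: `d = e + c • e` with `e` fixed by `N`; put `x = m₀ + e`
  obtain ⟨e, heN, hde⟩ := h0 d hdN hdc
  have hK1 : ∀ n : N, f.1 (cConj c n) = c • f.1 n + (m₀ + e) - (c * n * c⁻¹) • (m₀ + e) := fun n ↦ by
    have he : (c * (n : G) * c⁻¹) • e = e := by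
      have h := heN (cConj c n)
      rwa [cConj_coe] at h
    rw [hK1₀ n, smul_add, he]
    abel
  have hK2 : f.1 (cSq hc) = (m₀ + e) + c • (m₀ + e) := by
    have h' : f.1 (cSq hc) = d + m₀ + c • m₀ := by rw [hd]; abel
    rw [h', hde, smul_add]
    abel
  -- ### the extension `F(n) = f(n)`, `F(n c) = f(n) + n • x` across `G = N ⊔ N c`, `x = m₀ + e`
  set x : M := m₀ + e with hx
  let F : G → M := fun h ↦
    if hh : h ∈ N then f.1 ⟨h, hh⟩ else f.1 ⟨h * c⁻¹, mul_inv_mem_of_not_mem hc hh⟩ + (h * c⁻¹) • x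
  have hF_coe : ∀ n : N, F n = f.1 n := fun n ↦ by simp [F, n.2]
  have hF_coe_mul : ∀ n : N, F (n * c) = f.1 n + (n : G) • x := fun n ↦ by
    simp only [F, dif_neg (mul_not_mem hc n)]
    congr 2
    · apply Subtype.ext; simp
    · simp
  -- continuity (`N` open, `F` continuous on each coset)
  have hFcont : Continuous F := by
    refine continuous_discrete_rng.2 fun m ↦ ?_
    have hval : Topology.IsOpenEmbedding ((↑) : N → G) := hN.isOpenEmbedding_subtypeVal
    have h1 : IsOpen {n : N | f.1 n = m} := (isOpen_discrete {m}).preimage f.1.continuous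
    have hcont2 : Continuous fun n : N ↦ f.1 n + (n : G) • x := f.1.continuous.add ((hM _).comp continuous_subtype_val)
    have h2 : IsOpen {n : N | f.1 n + (n : G) • x = m} := (isOpen_discrete {m}).preimage hcont2
    have hset : F ⁻¹' {m} =
        ((↑) : N → G) '' {n : N | f.1 n = m} ∪ (fun h ↦ h * c) '' (((↑) : N → G) '' {n : N | f.1 n + (n : G) • x = m}) := by
      ext h
      simp only [Set.mem_preimage, Set.mem_singleton_iff, Set.mem_union, Set.mem_image, Set.mem_setOf_eq]
      constructor
      · intro hh
        by_cases hhN : h ∈ N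
        · refine Or.inl ⟨⟨h, hhN⟩, ?_, rfl⟩
          rw [← hF_coe ⟨h, hhN⟩]
          exact hh
        · refine Or.inr ⟨h * c⁻¹, ⟨⟨h * c⁻¹, mul_inv_mem_of_not_mem hc hhN⟩, ?_, rfl⟩, ?_⟩
          · have e' := hF_coe_mul ⟨h * c⁻¹, mul_inv_mem_of_not_mem hc hhN⟩
            rw [Subgroup.coe_mk, inv_mul_cancel_right] at e'
            rw [← e']
            exact hh
          · rw [inv_mul_cancel_right]
      · rintro (⟨n, hn, rfl⟩ | ⟨_, ⟨n, hn, rfl⟩, rfl⟩)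
        · rw [hF_coe]
          exact hn
        · rw [hF_coe_mul]
          exact hn
    rw [hset]
    exact (hval.isOpenMap _ h1).union ((Homeomorph.mulRight c).isOpenMap _ (hval.isOpenMap _ h2))
  -- the crossed-homomorphism identity on `G`: four coset cases, using (K1), (K2)
  have hFmul : ∀ g₁ g₂ : G, F (g₁ * g₂) = F g₁ + g₁ • F g₂ := by
    intro g₁ g₂
    rcases exists_eq_or_eq_mul hc g₁ with ⟨n₁, rfl⟩ | ⟨n₁, rfl⟩ <;>
      rcases exists_eq_or_eq_mul hc g₂ with ⟨n₂, rfl⟩ | ⟨n₂, rfl⟩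
    · -- `(n₁, n₂)`
      rw [← Subgroup.coe_mul, hF_coe, hF_coe, hF_coe, cocycle_mul]
    · -- `(n₁, n₂ c)`
      rw [← mul_assoc, ← Subgroup.coe_mul, hF_coe_mul, hF_coe, hF_coe_mul, cocycle_mul]
      simp only [Subgroup.coe_mul, smul_add, smul_smul]
      abel
    · -- `(n₁ c, n₂)`: `n₁ c n₂ = (n₁ (c n₂ c⁻¹)) c`
      have e' : (n₁ : G) * c * n₂ = ((n₁ * cConj c n₂ : N) : G) * c := by
        simp only [Subgroup.coe_mul, cConj_coe, mul_assoc, inv_mul_cancel, mul_one]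
      rw [e', hF_coe_mul, hF_coe_mul, hF_coe, cocycle_mul, hK1]
      simp only [Subgroup.coe_mul, cConj_coe, smul_add, smul_sub, smul_smul]
      simp only [mul_assoc]
      abel
    · -- `(n₁ c, n₂ c)`: `n₁ c n₂ c = n₁ (c n₂ c⁻¹) c²`
      have e' : (n₁ : G) * c * (n₂ * c) = ((n₁ * cConj c n₂ * cSq hc : N) : G) := by
        simp only [Subgroup.coe_mul, cConj_coe, cSq_coe, mul_assoc, inv_mul_cancel_left]
      rw [e', hF_coe, hF_coe_mul, hF_coe_mul, cocycle_mul, cocycle_mul, hK1, hK2]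
      simp only [Subgroup.coe_mul, cConj_coe, smul_add, smul_sub, smul_smul]
      simp only [mul_assoc, inv_mul_cancel, mul_one]
      abel
  let Fc : contOneCocycles (discreteTopRep G M) := ⟨⟨F, hFcont⟩, hFmul⟩
  refine ⟨oneCocycleClass _ Fc, ?_⟩
  rw [resSubgroupH1_oneCocycleClass]
  congr 1
  apply Subtype.ext
  ext n
  rw [resCocycle_apply]
  exact hF_coe n

/-- **The `2`-divisible case.**  If every `G`-fixed element of `M` (fixed by `N` and by `c`) is TWICE a `G`-fixed element, then
`Ĥ⁰(⟨c⟩, M^N) = 0` (`d = 2e = e + c • e`) and every `c_*`-invariant class of `H¹(N, M)` is a restriction from `G`.  (For `M = E(ℚ̄)`: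
`E(ℚ)` finite of odd order.) [cite: SerreGaloisCohomology1997, I §2.6 (b)] -/
theorem exists_resSubgroupH1_eq_of_conjH1_eq_of_twoDivisible (hN : IsOpen (N : Set G)) (hM : ∀ m : M, Continuous fun g : G ↦ g • m)
    (hc : ∀ b : G, Xor (b * c⁻¹ ∈ N) (b ∈ N))
    (h2 : ∀ d : M, (∀ n : N, (n : G) • d = d) → c • d = d → ∃ e : M, (∀ n : N, (n : G) • e = e) ∧ c • e = e ∧ d = e + e)
    {ξ : subgroupH1 N M} (hξ : conjH1 N M c ξ = ξ) :
    ∃ η : discreteH1 G M, resSubgroupH1 N M η = ξ := by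
  refine exists_resSubgroupH1_eq_of_conjH1_eq_of_tateH0 hN hM hc (fun d hdN hdc ↦ ?_) hξ
  obtain ⟨e, heN, hec, hde⟩ := h2 d hdN hdc
  exact ⟨e, heN, by rw [hec]; exact hde⟩

end InfRes

/-! ## §2 `E/ℚ` and a quadratic field `K`: `τ_*`-invariant classes of `H¹(K, E_K)` are restrictions -/

section Curve

variable (K : Type) [Field K] [NumberField K] (W : WeierstrassCurve ℚ)

/-- **INVARIANT CLASSES OF `H¹(K, E_K)` ARE RESTRICTIONS** for `E = W/ℚ` and a QUADRATIC number field `K` (`[K:ℚ] = 2`, `σ ≠ 1`,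
`τ = liftAut σ`), PROVIDED every `Γ_ℚ`-fixed point of `E(ℚ̄)` is twice a `Γ_ℚ`-fixed point (e.g. `E(ℚ)` finite of odd order — the
situation of U_T's frame, where `E(K) ⊗ ℚ = ℚ·y_K` is τ-anti-invariant and `E(ℚ)[2] = 0`): every `s ∈ H¹(K, E_K)` with `τ_* s = s`
is `res c`, `c ∈ H¹(ℚ, E)`.  Transport of §2 through the model map `galH1Model` of `ShaCorestrictionIndexTwo`
(`galH1Model_resBaseChange`, `galH1Model_conjH1Points`, `galH1ModelInv_galH1Model`).
[cite: SerreGaloisCohomology1997, I §2.6 (b), I §5.8] [cite: GrossLMS1991, §5 (5.1)–(5.2)] -/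
theorem exists_resBaseChange_eq_of_conjH1Points_eq_of_twoDivisible (h2 : Module.finrank ℚ K = 2) {σ : K ≃ₐ[ℚ] K} (hσ1 : σ ≠ 1)
    (hdiv : ∀ P : geomPoints W, (∀ g : Field.absoluteGaloisGroup ℚ, g • P = P) →
      ∃ Q : geomPoints W, (∀ g : Field.absoluteGaloisGroup ℚ, g • Q = Q) ∧ P = Q + Q)
    {s : (W.baseChange K).galH1} (hs : (isLiftOfAut_liftAut σ).conjH1Points W s = s) :
    ∃ b : W.galH1, resBaseChange W K b = s := by
  haveI : Algebra.IsQuadraticExtension ℚ K := ⟨h2⟩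
  haveI : IsGalois ℚ K := inferInstance
  haveI hNn : (galRange (K := ℚ) K).Normal := normal_galRange K h2 hσ1
  have hN : IsOpen (galRange (K := ℚ) K : Set (Field.absoluteGaloisGroup ℚ)) := isOpen_galRange K
  have hM : ∀ m : geomPoints W, Continuous fun g : Field.absoluteGaloisGroup ℚ ↦ g • m := fun P ↦
    continuous_smul_of_isOpen_stabilizer P (isOpen_stabilizer_point_holds W P)
  have hc := xor_galRange K h2 hσ1
  -- the subgroup-model statement
  have hξ : conjH1 (galRange (K := ℚ) K) (geomPoints W) (liftToAbsGal (K := ℚ) K σ) (galH1Model K W s) = galH1Model K W s := by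
    rw [← galH1Model_conjH1Points K W h2 hσ1, hs]
  have h2div : ∀ d : geomPoints W, (∀ n : galRange (K := ℚ) K, (n : Field.absoluteGaloisGroup ℚ) • d = d) →
      liftToAbsGal (K := ℚ) K σ • d = d →
      ∃ e : geomPoints W, (∀ n : galRange (K := ℚ) K, (n : Field.absoluteGaloisGroup ℚ) • e = e) ∧
        liftToAbsGal (K := ℚ) K σ • e = e ∧ d = e + e := by
    intro d hdN hdc
    -- `d` is fixed by all of `Γ_ℚ = N ⊔ N c`
    have hdG : ∀ g : Field.absoluteGaloisGroup ℚ, g • d = d := fun g ↦ by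
      rcases exists_eq_or_eq_mul hc g with ⟨n, rfl⟩ | ⟨n, rfl⟩
      · exact hdN n
      · rw [mul_smul, hdc, hdN n]
    obtain ⟨Q, hQ, hdQ⟩ := hdiv d hdG
    exact ⟨Q, fun n ↦ hQ n, hQ _, hdQ⟩
  obtain ⟨η, hη⟩ := exists_resSubgroupH1_eq_of_conjH1_eq_of_twoDivisible hN hM hc h2div hξ
  refine ⟨η, galH1Model_injective K W ?_⟩
  rw [galH1Model_resBaseChange, hη]

end Curve


/-! ## §3 The `ℚ`-rational form: `E(ℚ)` 2-divisible in itself (e.g. finite of odd order) -/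

section Rat

variable (K : Type) [Field K] [NumberField K] (W : WeierstrassCurve ℚ)

/-- **Invariant classes of `H¹(K, E_K)` are restrictions, `E(ℚ)`-form.**  `K` quadratic, `σ ≠ 1`, `τ = liftAut σ`; if every point of
`E(ℚ)` is twice a point of `E(ℚ)` then every `τ_*`-invariant `s ∈ H¹(K, E_K)` is `res c` (Galois descent `E(ℚ̄)^{Γ_ℚ} = E(ℚ)`,
`fixedPoints_eq_range_map_holds`, feeds §2). [cite: SerreGaloisCohomology1997, I §2.6 (b)] [cite: SilvermanAEC2009, VIII.§1 (proof of Prop. 1.2)] -/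
theorem exists_resBaseChange_eq_of_conjH1Points_eq_of_rat_twoDivisible (h2 : Module.finrank ℚ K = 2) {σ : K ≃ₐ[ℚ] K}
    (hσ1 : σ ≠ 1)
    (hodd : ∀ P : (W.baseChange ℚ).toAffine.Point, ∃ Q : (W.baseChange ℚ).toAffine.Point, P = Q + Q)
    {s : (W.baseChange K).galH1} (hs : (isLiftOfAut_liftAut σ).conjH1Points W s = s) :
    ∃ b : W.galH1, resBaseChange W K b = s := by
  refine exists_resBaseChange_eq_of_conjH1Points_eq_of_twoDivisible K W h2 hσ1 (fun P hP ↦ ?_) hs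
  have hmem : P ∈ MulAction.fixedPoints (Field.absoluteGaloisGroup ℚ) (geomPoints W) := hP
  rw [fixedPoints_eq_range_map_holds W] at hmem
  obtain ⟨P₀, hP₀⟩ := hmem
  obtain ⟨Q₀, hQ₀⟩ := hodd P₀
  have hQmem : (WeierstrassCurve.Affine.Point.baseChange ℚ (AlgebraicClosure ℚ) Q₀ : geomPoints W) ∈
      MulAction.fixedPoints (Field.absoluteGaloisGroup ℚ) (geomPoints W) := by
    rw [fixedPoints_eq_range_map_holds W]
    exact ⟨Q₀, rfl⟩
  refine ⟨WeierstrassCurve.Affine.Point.baseChange ℚ (AlgebraicClosure ℚ) Q₀, fun g ↦ hQmem g, ?_⟩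
  rw [← hP₀, hQ₀]
  exact map_add (WeierstrassCurve.Affine.Point.baseChange ℚ (AlgebraicClosure ℚ)) Q₀ Q₀

/-- **Invariant classes of `H¹(K, E_K)` are restrictions when `E(ℚ)` is finite of odd order** (then `P = 2 • ((#E(ℚ)+1)/2 • P)`): the
situation of U_T's frame (`E(K) ⊗ ℚ = ℚ · y_K` τ-anti-invariant, `E(ℚ)[2] = 0`). [cite: SerreGaloisCohomology1997, I §2.6 (b)]
[cite: GrossLMS1991, §5 (5.1)–(5.2)] -/
theorem exists_resBaseChange_eq_of_conjH1Points_eq_of_odd_card (h2 : Module.finrank ℚ K = 2) {σ : K ≃ₐ[ℚ] K} (hσ1 : σ ≠ 1)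
    [Finite (W.baseChange ℚ).toAffine.Point] (hodd : Odd (Nat.card (W.baseChange ℚ).toAffine.Point))
    {s : (W.baseChange K).galH1} (hs : (isLiftOfAut_liftAut σ).conjH1Points W s = s) :
    ∃ b : W.galH1, resBaseChange W K b = s := by
  refine exists_resBaseChange_eq_of_conjH1Points_eq_of_rat_twoDivisible K W h2 hσ1 (fun P ↦ ?_) hs
  obtain ⟨k, hk⟩ := hodd
  refine ⟨(k + 1) • P, ?_⟩
  rw [← add_nsmul, show k + 1 + (k + 1) = Nat.card (W.baseChange ℚ).toAffine.Point + 1 by omega, succ_nsmul,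
    card_nsmul_eq_zero', zero_add]

end Rat

end Summit.BirchSwinnertonDyer.BirchSwinnertonDyer.Theorems.GenusExact.PlusDescent

end
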